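import Summits.CriticalPhenomena.PercolationContinuityZ3.Theorems.PercNearOneGluingNoHeavyLowerTailSunflowerAndrasfaiIso
import Mathlib.Combinatorics.SimpleGraph.Circulant
import HarnessLib

/-!
# `NoHeavyLowerTail` (crux stmt-CriticalPhenomena-4575), abstract sunflower cubic: EVERY TRIANGLE-FREE CIRCULAR CLIQUE WITH THE
# ARC PROPERTY IS A-SAFE — the circular cliques `K_{n/(k+1)}` for `3k+1 ≤ n ≤ 3k+2`, in particular the HEPTAGON `C₇ = K_{7/3}`

Support file (seat `prim-ineq-prove-1` gen 48; `--supports stmt-CriticalPhenomena-4575`).  No `sorry`, no named facts, standard axioms.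
Memo: run/shared/lean/prim/prim-ineq-prove-1/FINDING-CIRCULAR-prove1-g48.md §1.

The CIRCULAR CLIQUE `K_{n/d}` (Vince 1988; Bondy–Hell 1990) is the graph on `ℤ_n` in which two points are adjacent iff their circular
distance is `≥ d`; it is triangle-free iff `n < 3d`, and its maximal independent sets are exactly the `n` arcs of `d` consecutive points
iff `n ≥ 3d - 2` (memo §1: three pairwise close points not in one arc force three gaps `≤ d - 1`).  The Andrásfai graph `And_d` is
`K_{(3d-1)/d}` (`arcGraph (d-1)` of `…SunflowerAndrasfaiCyclic`, `circClique_eq_arcGraph`); the only other triangle-free circular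
cliques with the arc property are the `K_{(3d-2)/d}`: `2K₂, C₇, K_{10/4}, K_{13/5}, …`.

OBSERVATION (this file).  **`K_{(3d-2)/d}` is an INDUCED subgraph of the Andrásfai graph `K_{(6d-4)/(2d-1)} = And_{2d-1}`**: doubling
`x ↦ 2x` embeds `ℤ_{3d-2}` onto the even residues of `ℤ_{6d-4}`, doubling circular distances; an even distance is `≥ 2d - 1` iff it is
`≥ 2d` (`doubleEmb`).  Hence, by the theorem that every Andrásfai graph has an A-safe core (`Arc.arcGraph_safe`, gen 42) and the
heredity of A-safety under induced subgraphs (`aSafe_of_embedding`, …SunflowerBlowup):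
* **`circClique_safe`**: for `3k+1 ≤ n ≤ 3k+2` and every product measure `p`, `Safe p (edgeCore (circClique n (k+1)))` — Lemma A
  (`∏ μ(V_i) ≤ μ(A)^(K-1)` for every number of petals) for every triangle-free circular clique with the arc property;
* `safe_circClique_comap`: the same for every blow-up of such a graph;
* **`safe_edgeCore_cycleGraph_seven`**: the heptagon `C₇ ≅ K_{7/3}` (`cycleGraphSevenIso`, multiplication by `3` on `ℤ₇`) has an
  A-safe graph core, and so has every blow-up of `C₇` (`safe_edgeCore_of_heptagon_blowup`).
(This corrects the remark in memo FINDING-BLOWUP-prove1-g42.md §8 that `C₇` is an induced subgraph of no Andrásfai graph: it is one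
of `And₅` on `14` vertices.  The odd cycles `C₉ = K_{9/4}, C₁₁ = K_{11/5}, …` do NOT have the arc property and are not induced subgraphs
of Andrásfai graphs; `C₉` is A-safe by the hybrid certificate of that memo, `C_{2m+1}` for `m ≥ 5` is open.)
-/

noncomputable section

namespace Summit.CriticalPhenomena.PercolationContinuityZ3.Theorems.SunflowerPartition

namespace SafeCalc

open Finset

namespace Arc

/-! ## Circular cliques -/

section CircClique

variable {n : ℕ} [NeZero n]

/-- The CIRCULAR CLIQUE `K_{n/d}` on `Fin n`: `u ~ v` iff `u ≠ v` and both forward distances are `≥ d` (circular distance `≥ d`).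
[Vince 1988; Bondy–Hell 1990; this presentation: this work] -/
def circClique (n d : ℕ) [NeZero n] : SimpleGraph (Fin n) where
  Adj u v := u ≠ v ∧ d ≤ fd u v ∧ d ≤ fd v u
  symm := ⟨fun _ _ ⟨h, h1, h2⟩ => ⟨h.symm, h2, h1⟩⟩
  loopless := ⟨fun _ h => h.1 rfl⟩

/-- Adjacency in `circClique`. -/
theorem circClique_adj {d : ℕ} {u v : Fin n} : (circClique n d).Adj u v ↔ u ≠ v ∧ d ≤ fd u v ∧ d ≤ fd v u := Iff.rfl

/-- Adjacency in `circClique` is decidable (used for the `decide` proof of `cycleGraphSevenIso`). -/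
instance circClique_decidableRel (d : ℕ) : DecidableRel (circClique n d).Adj :=
  fun _ _ => inferInstanceAs (Decidable (_ ∧ _ ∧ _))

end CircClique

variable {k : ℕ}

/-- The Andrásfai graph in its arc presentation is the circular clique `K_{(3k+2)/(k+1)}`. [this work] -/
theorem circClique_eq_arcGraph (k : ℕ) : circClique (3 * k + 2) (k + 1) = arcGraph k := by
  ext u v
  rw [circClique_adj, arcGraph_adj]
  constructor
  · rintro ⟨-, h1, h2⟩; exact ⟨h1, h2⟩
  · rintro ⟨h1, h2⟩
    refine ⟨fun h => ?_, h1, h2⟩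
    rw [h, fd_self] at h1; omega

/-! ## The doubling embedding `K_{(3k+1)/(k+1)} ↪ K_{(6k+2)/(2k+1)} = arcGraph (2k)` -/

/-- `3k+1 ≠ 0`. -/
instance neZero_three_mul_add_one (k : ℕ) : NeZero (3 * k + 1) := ⟨by omega⟩

/-- Doubling `x ↦ 2x` from `Fin (3k+1)` to `Fin (3(2k)+2) = Fin (6k+2)` (the even residues). [this work] -/
def double (k : ℕ) (x : Fin (3 * k + 1)) : Fin (3 * (2 * k) + 2) := ⟨2 * x.val, by have := x.isLt; omega⟩

/-- Value of `double`. -/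
@[simp] theorem double_val (x : Fin (3 * k + 1)) : ((double k x : Fin (3 * (2 * k) + 2)) : ℕ) = 2 * x.val := rfl

/-- Doubling doubles forward distances. [this work] -/
theorem fd_double (u v : Fin (3 * k + 1)) : fd (double k u) (double k v) = 2 * fd u v := by
  rw [fd_val, fd_val]
  have hu := u.isLt; have hv := v.isLt
  by_cases h : u ≤ v
  · have h' : double k u ≤ double k v := by rw [Fin.le_def, double_val, double_val]; rw [Fin.le_def] at h; omega
    rw [if_pos h, if_pos h', double_val, double_val]; rw [Fin.le_def] at h; omega
  · have h' : ¬ double k u ≤ double k v := by rw [Fin.le_def, double_val, double_val]; rw [Fin.le_def] at h; omega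
    rw [if_neg h, if_neg h', double_val, double_val]; rw [Fin.le_def] at h; omega

/-- `double` is injective. -/
theorem double_injective : Function.Injective (double k) := by
  intro u v h
  have := congrArg Fin.val h
  rw [double_val, double_val] at this
  exact Fin.ext (by omega)

/-- Adjacency is transported by doubling: an even circular distance exceeds `2k` iff the halved distance exceeds `k`. [this work] -/
theorem arcGraph_adj_double (u v : Fin (3 * k + 1)) :
    (arcGraph (2 * k)).Adj (double k u) (double k v) ↔ (circClique (3 * k + 1) (k + 1)).Adj u v := by
  rw [arcGraph_adj, circClique_adj, fd_double, fd_double]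
  constructor
  · rintro ⟨h1, h2⟩
    refine ⟨fun h => ?_, by omega, by omega⟩
    rw [h, fd_self] at h1; omega
  · rintro ⟨-, h1, h2⟩; exact ⟨by omega, by omega⟩

/-- **The circular clique `K_{(3k+1)/(k+1)}` is an induced subgraph of the Andrásfai graph `arcGraph (2k) = K_{(6k+2)/(2k+1)}`**
(the even residues). [this work] -/
def doubleEmb (k : ℕ) : circClique (3 * k + 1) (k + 1) ↪g arcGraph (2 * k) where
  toFun := double k
  inj' := double_injective
  map_rel_iff' := fun {a b} => arcGraph_adj_double a b

/-- `K_{(3k+1)/(k+1)}` has an A-safe graph core. [this work] -/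
theorem circClique_three_mul_add_one_safe (k : ℕ) (p : Fin (3 * k + 1) → unitInterval) :
    Safe p (edgeCore (circClique (3 * k + 1) (k + 1))) :=
  aSafe_of_embedding (doubleEmb k) (fun q => arcGraph_safe (2 * k) q) p

/-- `K_{(3k+2)/(k+1)} = And_{k+1}` has an A-safe graph core (restatement of `arcGraph_safe`). [this work] -/
theorem circClique_three_mul_add_two_safe (k : ℕ) (p : Fin (3 * k + 2) → unitInterval) :
    Safe p (edgeCore (circClique (3 * k + 2) (k + 1))) := by
  rw [circClique_eq_arcGraph]; exact arcGraph_safe k p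

/-- Relabelling a circular clique along `Fin.cast`. -/
theorem circClique_adj_cast {n m : ℕ} [NeZero n] [NeZero m] (h : n = m) (d : ℕ) (u v : Fin n) :
    (circClique m d).Adj (Fin.cast h u) (Fin.cast h v) ↔ (circClique n d).Adj u v := by
  subst h
  rfl

/-- The relabelling `Fin.cast` as a graph embedding of circular cliques. [this work] -/
def castEmb {n m : ℕ} [NeZero n] [NeZero m] (h : n = m) (d : ℕ) : circClique n d ↪g circClique m d where
  toFun := Fin.cast h
  inj' := Fin.cast_injective h
  map_rel_iff' := fun {a b} => circClique_adj_cast h d a b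

/-- **THEOREM.  Every triangle-free circular clique with the arc property has an A-safe graph core**: for `3k+1 ≤ n ≤ 3k+2` and
every product measure `p` on `Fin n`, `Safe p (edgeCore (circClique n (k+1)))` — Lemma A `∏ μ(V_i) ≤ μ(A)^(K-1)` for every number
of petals (hence the (C1-law), `H/G/T`, `GW_k`, Kahn-5 rows via `…SunflowerSafeCalculus`). [this work] -/
theorem circClique_safe {n : ℕ} [NeZero n] (k : ℕ) (h1 : 3 * k + 1 ≤ n) (h2 : n ≤ 3 * k + 2) (p : Fin n → unitInterval) :
    Safe p (edgeCore (circClique n (k + 1))) := by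
  rcases Nat.eq_or_lt_of_le h2 with h | h
  · exact aSafe_of_embedding (castEmb h (k + 1)) (fun q => circClique_three_mul_add_two_safe k q) p
  · have h' : n = 3 * k + 1 := by omega
    exact aSafe_of_embedding (castEmb h' (k + 1)) (fun q => circClique_three_mul_add_one_safe k q) p

/-- Hence every BLOW-UP of such a circular clique (vertices replaced by independent classes, adjacent classes completely joined) has
an A-safe graph core. [this work] -/
theorem safe_circClique_comap {ι : Type*} [Fintype ι] {n : ℕ} [NeZero n] (k : ℕ) (h1 : 3 * k + 1 ≤ n) (h2 : n ≤ 3 * k + 2)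
    (f : ι → Fin n) (p : ι → unitInterval) : Safe p (edgeCore ((circClique n (k + 1)).comap f)) :=
  aSafe_edgeCore_comap f _ (fun q => circClique_safe k h1 h2 q) p

/-! ## The heptagon -/

/-- Multiplication by `3` on `Fin 7`, the vertex map of `C₇ ≅ K_{7/3}`. [this work] -/
def mulThree (x : Fin 7) : Fin 7 := ⟨(3 * x.val) % 7, Nat.mod_lt _ (by omega)⟩

/-- **`C₇ ≅ K_{7/3}`**: Mathlib's `cycleGraph 7` is isomorphic to the circular clique `circClique 7 3` (via `x ↦ 3x`). [this work] -/
def cycleGraphSevenIso : SimpleGraph.cycleGraph 7 ≃g circClique 7 3 where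
  toEquiv := Equiv.ofBijective mulThree (by decide)
  map_rel_iff' := by
    intro a b
    change (circClique 7 3).Adj (mulThree a) (mulThree b) ↔ (SimpleGraph.cycleGraph 7).Adj a b
    revert a b
    decide

/-- **THE HEPTAGON HAS AN A-SAFE GRAPH CORE**: `Safe p (edgeCore (cycleGraph 7))` for every product measure `p` (Lemma A for every
number of petals). [this work] -/
theorem safe_edgeCore_cycleGraph_seven (p : Fin 7 → unitInterval) : Safe p (edgeCore (SimpleGraph.cycleGraph 7)) :=
  aSafe_of_embedding cycleGraphSevenIso.toEmbedding (fun q => circClique_safe (n := 7) 2 (by omega) (by omega) q) p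

/-- And every blow-up of the heptagon (`Γ.Adj u v ↔ (cycleGraph 7).Adj (f u) (f v)` for some `f : ι → Fin 7`) has an A-safe graph
core. [this work] -/
theorem safe_edgeCore_of_heptagon_blowup {ι : Type*} [Fintype ι] (Γ : SimpleGraph ι) (f : ι → Fin 7)
    (hΓ : ∀ u v, Γ.Adj u v ↔ (SimpleGraph.cycleGraph 7).Adj (f u) (f v)) (p : ι → unitInterval) : Safe p (edgeCore Γ) := by
  have h : (SimpleGraph.cycleGraph 7).comap f = Γ := by
    ext u v
    exact (hΓ u v).symm
  rw [← h]
  exact aSafe_edgeCore_comap f _ safe_edgeCore_cycleGraph_seven p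

end Arc

end SafeCalc

end Summit.CriticalPhenomena.PercolationContinuityZ3.Theorems.SunflowerPartition
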